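import Summits.ABC.StewartYu.MatveevLatticeLever
import Literature.NumberTheory.DiophantineGeometry.MultiplicativeGroupApproximationProp434Proofs
import Mathlib.Data.Fin.Tuple.Sort
import Mathlib.Data.Nat.Factorial.BigOperators
import HarnessLib

/-!
# Cell abc-stewartyu, Gen-3 frames: Matveev's step RE-BASES the obstruction lattice — a `ℤ`-basis of
# `Φ` with controlled weighted norms (lattice lever ∘ sort ∘ Mahler's basis theorem)

`Summits/ABC/StewartYu/MatveevRebase.lean` — cell `abc-stewartyu` (route `PadicPrimesKummerThird`, cruxes
`Y07Odd` stmt-ABC-19658 / `Y07Two` stmt-ABC-19659), seat p3 (g4), F-two lead.  Theorems only.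

The lattice lever (lit g5, `Summit.ABC.StewartYu.LatticeLever.exists_short_lattice_vectors`, Nesterenko
2003 (2.13) via Minkowski II) produces `r` INDEPENDENT short vectors `vₖ·a` in the lattice `Φ = span_ℤ(a)`
(`a` a basis of `Φ`, e.g. the rows `M` of `Nesterenko2003_prop51`); their span is only a finite-index
sublattice of `Φ`.  For the `q`-Kummer condition to survive Matveev's change of generators
(`KummerBasisChange.mulIndep_and_kummer_of_chars`: it needs a basis of the SATURATED lattice `Φ` itself),
the frame must pass to a `ℤ`-BASIS of `Φ` with comparable norms: Mahler's basis theorem (tree: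
`Dioph.exists_int_basis_le_of_directional`, Evertse–Győry Thm 4.3.3: `N(yⱼ) ≤ (j+1)·N(vⱼ)` for a sorted
directional system) does exactly this, at the cost of one more `r!`.

* `exists_weightedSeminorm_rows` — the pulled-back weighted `ℓ¹`-norm `N(y) = ∑ₗ Aₗ |∑ᵢ yᵢ aᵢₗ|` on `ℝʳ`
  as a `Seminorm`;
* HEADLINE `exists_basis_prod_norm_le` — for `a : Fin r → ℤⁿ` `ℚ`-independent (`r ≥ 1`) and weights
  `Aₗ > 0`: there are `y : Fin r → ℤʳ` spanning `ℤʳ` (so the rows `∑ₖ yⱼₖ aₖ` are a `ℤ`-basis of `Φ`) and the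
  maximal weighted minor `κ` of the lever, with
  `∏ⱼ ‖∑ₖ yⱼₖ aₖ‖_A ≤ (r!)² · nʳ · (|det a_κ| · ∏ᵢ A_{κ i})`
  (lever's `r!·nʳ` × Mahler's `∏(j+1) = r!`); the right-hand side is what E's exit C bounds by the zero
  estimate's minors sum (`≤ Σ_I |det M_I| A_I`), and the `(r!)²nʳ` is absorbed by the frames' parameter
  slack `2^{−(r+1)(n+23)}` (Nesterenko (5.22)).

References: Yu. V. Nesterenko, LNM 1819 (2003), Prop. 2.6 (2.13); J.-H. Evertse, K. Győry, *Unit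
Equations in Diophantine Number Theory* (2015), Thm 4.3.3 (Mahler); K. Mahler 1938 / Cassels,
*Geometry of Numbers*, V.4.
-/

noncomputable section

open Finset
open Literature.NumberTheory.DiophantineGeometry.Dioph

namespace Summit.ABC.StewartYu.MatveevRebase

variable {n r : ℕ}

/-- The weighted `ℓ¹`-norm pulled back along `y ↦ ∑ᵢ yᵢ aᵢ`: `N(y) = ∑ₗ Aₗ |∑ᵢ yᵢ aᵢₗ|` is a seminorm
on `ℝʳ` (`Aₗ ≥ 0`). [folklore] -/
theorem exists_weightedSeminorm_rows {A : Fin n → ℝ} (hA : ∀ l, 0 ≤ A l) (a : Fin r → Fin n → ℤ) :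
    ∃ N : Seminorm ℝ (Fin r → ℝ), ∀ y, N y = ∑ l, A l * |∑ i, y i * (a i l : ℝ)| := by
  refine ⟨Seminorm.of (fun y => ∑ l, A l * |∑ i, y i * (a i l : ℝ)|) (fun x y => ?_) (fun c x => ?_),
    fun y => rfl⟩
  · rw [← Finset.sum_add_distrib]
    refine Finset.sum_le_sum fun l _ => ?_
    rw [← mul_add]
    refine mul_le_mul_of_nonneg_left ?_ (hA l)
    have : ∑ i, (x + y) i * (a i l : ℝ) = ∑ i, x i * (a i l : ℝ) + ∑ i, y i * (a i l : ℝ) := by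
      rw [← Finset.sum_add_distrib]
      refine Finset.sum_congr rfl fun i _ => by rw [Pi.add_apply, add_mul]
    rw [this]
    exact abs_add_le _ _
  · rw [Finset.mul_sum]
    refine Finset.sum_congr rfl fun l _ => ?_
    have : ∑ i, (c • x) i * (a i l : ℝ) = c * ∑ i, x i * (a i l : ℝ) := by
      rw [Finset.mul_sum]
      refine Finset.sum_congr rfl fun i _ => by rw [Pi.smul_apply, smul_eq_mul, mul_assoc]
    rw [this, abs_mul, Real.norm_eq_abs]; ring

/-- `∏_{j < r} (j + 1) = r!` over `Fin r`, in `ℝ`. [folklore] -/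
theorem prod_fin_succ_eq_factorial (r : ℕ) : ∏ j : Fin r, ((j : ℕ) + 1 : ℝ) = (r.factorial : ℝ) := by
  have h := Fin.prod_univ_eq_prod_range (fun i : ℕ => ((i : ℝ) + 1)) r
  rw [h, ← Finset.prod_range_add_one_eq_factorial]
  push_cast
  rfl

/-- **HEADLINE — a `ℤ`-basis of `Φ = span_ℤ(a)` with a product bound on its weighted norms**
(lever ∘ sort ∘ Mahler).  For `a : Fin r → ℤⁿ` independent over `ℚ` (`r ≥ 1`) and weights `Aₗ > 0` there
are integer rows `y₀, …, y_{r−1}` spanning `ℤʳ` and an injective `κ : Fin r → Fin n` picking a maximal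
weighted minor (`det a_κ ≠ 0`) such that the rows `zⱼ = ∑ₖ yⱼₖ aₖ` (a `ℤ`-basis of `Φ`) satisfy
`∏ⱼ ‖zⱼ‖_A ≤ (r!)²·nʳ·(|det a_κ|·∏ᵢ A_{κ i})`. [cite: Nesterenko2003, Prop 2.6 (2.13)] -/
theorem exists_basis_prod_norm_le (hr : 0 < r) {A : Fin n → ℝ} (hA : ∀ l, 0 < A l)
    (a : Fin r → Fin n → ℤ) (ha : LinearIndependent ℚ (fun i => fun l => (a i l : ℚ))) :
    ∃ (y : Fin r → Fin r → ℤ) (κ : Fin r → Fin n), Function.Injective κ ∧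
      Submodule.span ℤ (Set.range y) = ⊤ ∧
      (Matrix.of fun i j => (a j (κ i) : ℝ)).det ≠ 0 ∧
      (∀ κ' : Fin r → Fin n,
        |(Matrix.of fun i j => (a j (κ' i) : ℝ)).det| * ∏ i, A (κ' i) ≤
          |(Matrix.of fun i j => (a j (κ i) : ℝ)).det| * ∏ i, A (κ i)) ∧
      ∏ j, (∑ l, A l * |((∑ k, y j k * a k l : ℤ) : ℝ)|) ≤
        ((r.factorial : ℝ)) ^ 2 * (n : ℝ) ^ r *
          (|(Matrix.of fun i j => (a j (κ i) : ℝ)).det| * ∏ i, A (κ i)) := by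
  classical
  obtain ⟨v, κ, hκinj, hvli, hdet, hmax, hprod⟩ :=
    Summit.ABC.StewartYu.LatticeLever.exists_short_lattice_vectors hr hA a ha
  obtain ⟨N, hN⟩ := exists_weightedSeminorm_rows (fun l => (hA l).le) a
  -- sort the directional system by norm
  set σ : Equiv.Perm (Fin r) := Tuple.sort fun k => N (fun i => (v k i : ℝ)) with hσ
  set v' : Fin r → Fin r → ℤ := fun k => v (σ k) with hv'
  have hv'li : LinearIndependent ℝ (fun k i => (v' k i : ℝ)) := by
    have : (fun k i => (v' k i : ℝ)) = (fun k i => (v k i : ℝ)) ∘ σ := rfl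
    rw [this]
    exact hvli.comp σ σ.injective
  have hmono : Monotone (fun k => N (fun i => (v' k i : ℝ))) := by
    have : (fun k => N (fun i => (v' k i : ℝ))) = (fun k => N (fun i => (v k i : ℝ))) ∘ σ := rfl
    rw [this, hσ]
    exact Tuple.monotone_sort _
  -- Mahler's basis
  obtain ⟨y, hyspan, _hyne, hyle⟩ := exists_int_basis_le_of_directional N v' hv'li hmono
  refine ⟨y, κ, hκinj, hyspan, hdet, hmax, ?_⟩
  -- the norms in `N`-form
  have hNy : ∀ j, (∑ l, A l * |((∑ k, y j k * a k l : ℤ) : ℝ)|) = N (fun i => (y j i : ℝ)) := by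
    intro j; rw [hN]; push_cast; rfl
  have hNv : ∀ k, (∑ l, A l * |((∑ i, v k i * a i l : ℤ) : ℝ)|) = N (fun i => (v k i : ℝ)) := by
    intro k; rw [hN]; push_cast; rfl
  have hN0 : ∀ x, 0 ≤ N x := fun x => apply_nonneg N x
  calc ∏ j, (∑ l, A l * |((∑ k, y j k * a k l : ℤ) : ℝ)|)
      = ∏ j, N (fun i => (y j i : ℝ)) := Finset.prod_congr rfl fun j _ => hNy j
    _ ≤ ∏ j : Fin r, (((j : ℕ) + 1 : ℝ) * N (fun i => (v' j i : ℝ))) :=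
        Finset.prod_le_prod (fun j _ => hN0 _) fun j _ => hyle j
    _ = (∏ j : Fin r, ((j : ℕ) + 1 : ℝ)) * ∏ j, N (fun i => (v' j i : ℝ)) := Finset.prod_mul_distrib
    _ = (r.factorial : ℝ) * ∏ k, N (fun i => (v k i : ℝ)) := by
        rw [prod_fin_succ_eq_factorial]
        congr 1
        exact Equiv.prod_comp σ (fun k => N (fun i => (v k i : ℝ)))
    _ = (r.factorial : ℝ) * ∏ k, (∑ l, A l * |((∑ i, v k i * a i l : ℤ) : ℝ)|) := by
        congr 1; exact Finset.prod_congr rfl fun k _ => (hNv k).symm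
    _ ≤ (r.factorial : ℝ) * ((r.factorial : ℝ) * (n : ℝ) ^ r *
          (|(Matrix.of fun i j => (a j (κ i) : ℝ)).det| * ∏ i, A (κ i))) :=
        mul_le_mul_of_nonneg_left hprod (Nat.cast_nonneg _)
    _ = ((r.factorial : ℝ)) ^ 2 * (n : ℝ) ^ r *
          (|(Matrix.of fun i j => (a j (κ i) : ℝ)).det| * ∏ i, A (κ i)) := by ring

end Summit.ABC.StewartYu.MatveevRebase

end
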